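import Literature.Geometry.Kaehler.ComplexTorusLefschetzGroupMatrixUnitPairFamilyConnected
import Literature.Geometry.Kaehler.ComplexTorusEndomorphismAlgebraRealStructure
import HarnessLib

/-!
# Milne 1999 §2, «simple abelian variety of type IV», at torus level, EVERY degree `d`: for a simple polarised complex
# torus of Albert type IV, `S(X)(ℂ)` is CONNECTED — `Lf(X)(ℂ) = S(X)(ℂ)` («IV ∣ GL ∣ Semisimple: No ∣ Connected: Yes»)

Layer `Literature/Geometry/Kaehler`, namespace `Literature.Geometry.Kaehler.ComplexTorus`; lane `lit-hodgefound`
(Track 2 foundations library), Layer A4 (Lefschetz groups), GAP row **A4-90 (type IV, every degree `d ≥ 1`)** of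
`run/shared/lean/pub/lit-hodgefound/SKELETON.md`, FILE 2 of 2.  Sequel BY NAME of FILE 1
`ComplexTorusLefschetzGroupMatrixUnitPairFamilyConnected` (`isPrime_vanishingIdealC_lefschetzGroupC_of_matrixUnitPairFamily`,
`lefschetzIdentityC_eq_lefschetzGroupC_of_matrixUnitPairFamily`: a complete family of PAIRED `d × d` matrix-unit systems
with pair-swapping adjoints makes `S(X)(ℂ)` irreducible), of p12's `ComplexTorusEndomorphismAlgebraRealStructure`
(`IsSimple.exists_algEquiv_pi_matrix_star_of_isAlbertTypeIV`: `ℝ ⊗_ℚ End_ℚ(X) ≃ₐ[ℝ] ∏_w M_d(ℂ)` carrying the Rosati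
involution to factorwise CONJUGATE transposition, `d = Nat.sqrt [End_ℚ(X) : K]`), of `ComplexTorusRosati` /
`ComplexTorusRosatiAlbert` (`rosati`, `rosatiEnd`, `coe_rosatiEnd`, `rosati_map`, `rosati_mul`, …), of
`ComplexTorusLefschetzGroupIdentityComponent` (`lefschetzGroupC`, `lefschetzIdentityC`, `comap_lefschetzGroupC`), and the
every-`d` complement of skel-4's `ComplexTorusAlbertTypeILefschetzGroupConnected`
(`IsSimple.lefschetzIdentityC_eq_lefschetzGroupC_of_isAlbertTypeIV_of_finrank_eq_one`, `d = 1` only).  THEOREMS ONLY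
(no definition, no instance, no notation, no named fact; D-0026, net debt 0).

## Sources, verbatim

* J. S. Milne, *Lefschetz classes on abelian varieties*, Duke Math. J. **96** (1999) 639–675 (held
  `paper:doi-10-1215-s0012-7094-99-09620-5`). §2, p. 651 (p0013 L8–L30): «*Simple abelian variety of type IV.* In this
  case, `A` is simple and `E` is a division algebra of degree `d²` over its centre `F`, which is a CM-field. […]
  `E ⊗_{F,σ} k^al ≈ M_d(k^al) × M_d(k^al)` […]»; Remark 2.2 (p. 647–648): «The map `α ↦ α|V₁ : U(φ₀)_Ω → GL(V₁)` is an
  isomorphism»; Summary table p. 652: «IV ∣ GL ∣ No ∣ Yes».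
* H. Lange, *Abelian Varieties over the Complex Numbers* (2023), Thm. 2.6.5 / §2.6.1 (type IV:
  «`End_ℚ(X) ⊗_ℚ ℝ ≃ ∏ M_d(ℂ)` … the anti-involution translates into `x ↦ ᵗx̄`»), §7.2.4 Exercise (4).
* D. Mumford, *Abelian Varieties* (1970), §21, Thm. 2 and table (type IV: `D ⊗_ℚ ℝ ≅ ∏ M_d(ℂ)`).

## What is proved (`X = E/Ψ(ℤ^κ)` SIMPLE, polarised by `η` with rational Gram matrix `G`, of Albert type IV)

* §1 helpers: the base change `ψ : ℝ ⊗_ℚ End_ℚ(X) →ₐ[ℝ] M_κ(ℝ)`; the complementary idempotents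
  `p₋ = ½(P − q)`, `p₊ = ½(P + q)` of an element `q` with `q² = P`, `Pq = qP = q`, `P² = P` (`idempotent_pair`).
* §2 **`IsSimple.exists_matrixUnitPairFamily_of_isAlbertTypeIV`** — the hypotheses of FILE 1 are met: with
  `θ = ψ ∘ Φ⁻¹ : ∏_w M_d(ℂ) → M_κ(ℝ)` (`Φ` Lange's real structure), complexified, the block units `P_w = θ(δ_w 1)` and
  `I_w = θ(δ_w i·1)` give the two CENTRAL IDEMPOTENTS `p_{w,∓} = ½(P_w ∓ i I_w)` of `M_d(ℂ) ⊗_ℝ ℂ ≅ M_d(ℂ) × M_d(ℂ)`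
  («`E ⊗_{F,σ} k^al ≈ M_d(k^al) × M_d(k^al)`»); the units `e w s a b = p_{w,s} · θ(δ_w E_{ab})` satisfy the paired
  table, sum to `1`, span `span_ℂ End_ℚ(X)` together with it, and — because `†` is carried to CONJUGATE transposition,
  so that `I_w† = −I_w` and `p_{w,−}† = p_{w,+}` — have PAIR-SWAPPING adjoints `(e w s a b)† = e w s̄ b a`.
* §3 **MILNE'S TABLE, TYPE IV, EVERY `d`**: `IsSimple.isPrime_vanishingIdealC_lefschetzGroupC_of_isAlbertTypeIV`,
  **`IsSimple.lefschetzIdentityC_eq_lefschetzGroupC_of_isAlbertTypeIV`** (`Lf(X)(ℂ) = S(X)(ℂ)`), and the real points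
  `IsSimple.lefschetzIdentity_eq_lefschetzGroup_of_isAlbertTypeIV`.

Faithfulness notes. (i) As in the whole lane, `S(A)` enters through complex points and Lange's identity component.
(ii) Milne's `∏ GL` is reached through Remark 2.2 per conjugate pair of embeddings (FILE 1); the splitting
`V_σ = V₁ ⊕ V₂` is the one by the idempotents `p_{w,∓}`.  (iii) SIMPLE type IV only; products via A4-89 / A4-94 (d).

## References

* [Milne1999LefschetzClasses] J. S. Milne, *Lefschetz classes on abelian varieties*, Duke Math. J. 96 (1999)
  639–675: §2, Remark 2.2, «Simple abelian variety of type IV» (p. 651), Summary table (p. 652).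
* [Lange2023AbelianVarietiesComplex] H. Lange, *Abelian Varieties over the Complex Numbers* (2023), §2.6.1,
  Thm. 2.6.5, §7.2.4 Exercise (4).
* [MumfordAV1970] D. Mumford, *Abelian Varieties* (1970), §21, Thm. 2 and table.
* [Springer1998] T. A. Springer, *Linear Algebraic Groups*, 2nd ed. (1998), Exercise 2.2.2 (1), Prop. 2.2.1.
-/

noncomputable section

open Matrix NumberField Module
open scoped TensorProduct
open Literature.RingTheory.CentralSimple (IsAlbertTypeIV)

namespace Literature.Geometry.Kaehler

namespace ComplexTorus

/-! ## §1 Helpers: base change, central idempotents, spans -/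

section Helpers

/-- **Complementary idempotents from a square root of an idempotent**: if `P² = P`, `Pq = q = qP`, `q² = P` in a
`ℂ`-algebra, then `p₋ = ½(P − q)` and `p₊ = ½(P + q)` are orthogonal idempotents with `p₋ + p₊ = P`, `p₊ − p₋ = q`
(the two factors of `M_d(ℂ) ⊗_ℝ ℂ ≅ M_d(ℂ) × M_d(ℂ)`, `q = i ⊗ i`). [folklore] -/
private theorem idempotent_pair {R : Type*} [Ring R] [Algebra ℂ R] {P q : R} (hP : P * P = P) (hPq : P * q = q)
    (hqP : q * P = q) (hq : q * q = P) :
    ((2 : ℂ)⁻¹ • (P - q)) * ((2 : ℂ)⁻¹ • (P - q)) = (2 : ℂ)⁻¹ • (P - q) ∧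
      ((2 : ℂ)⁻¹ • (P + q)) * ((2 : ℂ)⁻¹ • (P + q)) = (2 : ℂ)⁻¹ • (P + q) ∧
        ((2 : ℂ)⁻¹ • (P - q)) * ((2 : ℂ)⁻¹ • (P + q)) = 0 ∧ ((2 : ℂ)⁻¹ • (P + q)) * ((2 : ℂ)⁻¹ • (P - q)) = 0 ∧
          (2 : ℂ)⁻¹ • (P - q) + (2 : ℂ)⁻¹ • (P + q) = P ∧ (2 : ℂ)⁻¹ • (P + q) - (2 : ℂ)⁻¹ • (P - q) = q := by
  refine ⟨?_, ?_, ?_, ?_, ?_, ?_⟩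
  · rw [smul_mul_smul_comm, sub_mul, mul_sub, mul_sub, hP, hPq, hqP, hq]
    module
  · rw [smul_mul_smul_comm, add_mul, mul_add, mul_add, hP, hPq, hqP, hq]
    module
  · rw [smul_mul_smul_comm, sub_mul, mul_add, mul_add, hP, hPq, hqP, hq]
    module
  · rw [smul_mul_smul_comm, add_mul, mul_sub, mul_sub, hP, hPq, hqP, hq]
    module
  · module
  · module

/-- `δ_w x · δ_{w'} y = 0` for `w ≠ w'`. [folklore] -/
private theorem pi_single_mul_single_of_ne_cm {W : Type*} [DecidableEq W] {M : Type*} [MulZeroClass M] {w w' : W}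
    (h : w ≠ w') (x y : M) : (Pi.single w x : W → M) * Pi.single w' y = 0 := by
  funext v
  rw [Pi.mul_apply, Pi.zero_apply]
  by_cases hv : v = w
  · subst hv
    rw [Pi.single_eq_of_ne h, mul_zero]
  · rw [Pi.single_eq_of_ne hv, zero_mul]

/-- `δ_w (c·1)` is central in `∏_w M_n(ℂ)`. [folklore] -/
private theorem pi_single_smul_one_comm {W : Type*} [DecidableEq W] {n : Type*} [Fintype n] [DecidableEq n] (w : W)
    (c : ℂ) (y : W → Matrix n n ℂ) :
    (Pi.single w (c • (1 : Matrix n n ℂ)) : W → Matrix n n ℂ) * y = y * Pi.single w (c • (1 : Matrix n n ℂ)) := by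
  funext v
  rw [Pi.mul_apply, Pi.mul_apply]
  by_cases hv : v = w
  · subst hv
    rw [Pi.single_eq_same, smul_mul_assoc, one_mul, mul_smul_comm, mul_one]
  · rw [Pi.single_eq_of_ne hv, zero_mul, mul_zero]

/-- `δ_w (Σ_x g x) = Σ_x δ_w (g x)`. [folklore] -/
private theorem pi_single_sum_cm {W : Type*} [DecidableEq W] {M : Type*} [AddCommMonoid M] {α : Type*} (w : W)
    (s : Finset α) (g : α → M) : (Pi.single w (∑ x ∈ s, g x) : W → M) = ∑ x ∈ s, Pi.single w (g x) :=
  map_sum (AddMonoidHom.single (fun _ : W ↦ M) w) g s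

/-- `ᵗĒ_{ab} = E_{ba}` for the elementary matrices. [folklore] -/
private theorem star_single_one {n : Type*} [DecidableEq n] (a b : n) :
    star (Matrix.single a b (1 : ℂ)) = Matrix.single b a 1 := by
  rw [Matrix.star_eq_conjTranspose]
  ext i j
  rw [Matrix.conjTranspose_apply, Matrix.single, Matrix.single, Matrix.of_apply, Matrix.of_apply]
  by_cases h : a = j ∧ b = i
  · rw [if_pos h, if_pos ⟨h.2, h.1⟩, star_one]
  · rw [if_neg h, if_neg fun H ↦ h ⟨H.2, H.1⟩, star_zero]

/-- `E_{ab} E_{cd} = δ_{bc} E_{ad}`. [folklore] -/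
private theorem single_mul_single_cm {n : Type*} [Fintype n] [DecidableEq n] (a b c d : n) :
    Matrix.single a b (1 : ℂ) * Matrix.single c d (1 : ℂ) = if b = c then Matrix.single a d 1 else 0 := by
  by_cases h : b = c
  · subst h
    rw [if_pos rfl, Matrix.single_mul_single_same, mul_one]
  · rw [if_neg h]
    simp [h]

/-- `Σ_a E_{aa} = 1`. [folklore] -/
private theorem sum_single_diag_one {n : Type*} [Fintype n] [DecidableEq n] :
    ∑ a, Matrix.single a a (1 : ℂ) = (1 : Matrix n n ℂ) := by
  ext i j
  simp only [Matrix.sum_apply, Matrix.single, Matrix.of_apply, Matrix.one_apply]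
  by_cases hij : i = j
  · subst hij
    rw [if_pos rfl, Finset.sum_eq_single i (fun a _ ha ↦ if_neg fun H ↦ ha H.1) (fun h ↦ (h (Finset.mem_univ _)).elim),
      if_pos ⟨rfl, rfl⟩]
  · rw [if_neg hij]
    exact Finset.sum_eq_zero fun a _ ↦ if_neg fun H ↦ hij (H.1.symm.trans H.2)

/-- A complex elementary matrix through real scalars: `z E_{ab} = Re z · E_{ab} + Im z · (i E_{ab})`. [folklore] -/
private theorem single_eq_re_smul_add_im_smul {n : Type*} [DecidableEq n] (a b : n) (z : ℂ) :
    Matrix.single a b z = z.re • Matrix.single a b (1 : ℂ) + z.im • Matrix.single a b (Complex.I : ℂ) := by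
  ext i j
  simp only [Matrix.add_apply, Matrix.smul_apply, Matrix.single, Matrix.of_apply]
  by_cases h : a = i ∧ b = j
  · simp only [if_pos h, Complex.real_smul, mul_one]
    exact (Complex.re_add_im z).symm
  · simp only [if_neg h, smul_zero, add_zero]

variable {κ : Type} [Fintype κ] [DecidableEq κ] {E : Type*} [NormedAddCommGroup E] [NormedSpace ℂ E]
  (Ψ : (κ → ℝ) ≃L[ℝ] E)

/-- The base change `ψ : ℝ ⊗_ℚ End_ℚ(X) →ₐ[ℝ] M_κ(ℝ)`, `r ⊗ f ↦ r · f_ℝ`. [cite: Lange2023AbelianVarietiesComplex, §2.6.1 (`End_ℚ(X) ⊗_ℚ ℝ`)] -/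
private theorem exists_baseChange_cm :
    ∃ ψ : ℝ ⊗[ℚ] endAlgRat Ψ →ₐ[ℝ] Matrix κ κ ℝ,
      ∀ (r : ℝ) (f : endAlgRat Ψ), ψ (r ⊗ₜ f) = r • (f : Matrix κ κ ℚ).map (Rat.cast : ℚ → ℝ) := by
  refine ⟨Algebra.TensorProduct.lift (Algebra.ofId ℝ (Matrix κ κ ℝ))
    (((Algebra.ofId ℚ ℝ).mapMatrix).comp (endAlgRat Ψ).val) (fun r f ↦ Algebra.commute_algebraMap_left r _),
    fun r f ↦ ?_⟩
  rw [Algebra.TensorProduct.lift_tmul, Algebra.ofId_apply, ← Algebra.smul_def, AlgHom.comp_apply,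
    AlgHom.mapMatrix_apply]
  rfl

omit [Fintype κ] [DecidableEq κ] in
/-- `G_ℂ = (G_ℝ)_ℂ`. [folklore] -/
private theorem map_algebraMap_eq_map_map_cm (G : Matrix κ κ ℚ) :
    G.map (algebraMap ℚ ℂ) = (G.map (Rat.cast : ℚ → ℝ)).map (algebraMap ℝ ℂ) := by
  rw [Matrix.map_map]
  exact congrArg G.map (funext fun q ↦ (eq_ratCast _ q).trans (map_ratCast (algebraMap ℝ ℂ) q).symm)

/-- `span_ℂ (End_ℚ(X) ⊗ 1)` is closed under products. [folklore] -/
private theorem mul_mem_span_endAlgRat_cm {x y : Matrix κ κ ℂ}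
    (hx : x ∈ Submodule.span ℂ ((fun A : Matrix κ κ ℚ ↦ A.map (algebraMap ℚ ℂ)) '' (endAlgRat Ψ : Set (Matrix κ κ ℚ))))
    (hy : y ∈ Submodule.span ℂ ((fun A : Matrix κ κ ℚ ↦ A.map (algebraMap ℚ ℂ)) '' (endAlgRat Ψ : Set (Matrix κ κ ℚ)))) :
    x * y ∈ Submodule.span ℂ ((fun A : Matrix κ κ ℚ ↦ A.map (algebraMap ℚ ℂ)) '' (endAlgRat Ψ : Set (Matrix κ κ ℚ))) := by
  induction hx using Submodule.span_induction with
  | mem a ha =>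
    obtain ⟨A, hA, rfl⟩ := ha
    induction hy using Submodule.span_induction with
    | mem b hb =>
      obtain ⟨B, hB, rfl⟩ := hb
      rw [← Matrix.map_mul]
      exact Submodule.subset_span ⟨A * B, (endAlgRat Ψ).mul_mem hA hB, rfl⟩
    | zero => rw [mul_zero]; exact Submodule.zero_mem _
    | add u v _ _ hu hv => rw [mul_add]; exact Submodule.add_mem _ hu hv
    | smul c u _ hu => rw [mul_smul_comm]; exact Submodule.smul_mem _ c hu
  | zero => rw [zero_mul]; exact Submodule.zero_mem _
  | add u v _ _ hu hv => rw [add_mul]; exact Submodule.add_mem _ hu hv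
  | smul c u _ hu => rw [smul_mul_assoc]; exact Submodule.smul_mem _ c hu

end Helpers

/-! ## §2 The paired family of matrix units of a simple polarised torus of Albert type IV -/

section MatrixUnitPairs

variable {κ : Type} [Fintype κ] [DecidableEq κ] [Nonempty κ] {E : Type*} [NormedAddCommGroup E]
  [NormedSpace ℂ E] {Ψ : (κ → ℝ) ≃L[ℝ] E} {η : E [⋀^Fin 2]→L[ℝ] ℝ} {G : Matrix κ κ ℚ}

/-- **A SIMPLE POLARISED COMPLEX TORUS OF ALBERT TYPE IV CARRIES A COMPLETE FAMILY OF PAIRED `d × d` MATRIX-UNIT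
SYSTEMS IN `End_ℚ(X) ⊗ ℂ` WITH PAIR-SWAPPING ADJOINTS** (`d = Nat.sqrt [End_ℚ(X) : K]`), Milne's
«`E ⊗_{F,σ} k^al ≈ M_d(k^al) × M_d(k^al)`» made explicit: from Lange's `Φ : ℝ ⊗_ℚ End_ℚ(X) ≃ ∏_w M_d(ℂ)`
(′ ↦ conjugate transposition) through the base change `ψ` and `θ = ψ ∘ Φ⁻¹`, with `P_w = θ(δ_w 1)`, `I_w = θ(δ_w i)`
and the central idempotents `p_{w,0} = ½(P_w − i I_w)`, `p_{w,1} = ½(P_w + i I_w)` (complexified), the units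
`e w s a b = p_{w,s} · θ(δ_w E_{ab})` satisfy the table at each block, are orthogonal across blocks (two clauses, so no
decidability of equality of places enters the statement), sum to `1`, lie in `span_ℂ End_ℚ(X)` and span it, and
`(e w s a b)† = e w s̄ b a` for `† = rosati G_ℂ` (since `I_w† = θ(δ_w ī) = −I_w`).
[cite: Lange2023AbelianVarietiesComplex, Thm. 2.6.5 / §2.6.1 (type IV real structure)]
[cite: Milne1999LefschetzClasses, §2 «Simple abelian variety of type IV» (p. 651)] -/
theorem IsSimple.exists_matrixUnitPairFamily_of_isAlbertTypeIV (hX : IsSimple Ψ) (hη : IsRiemannForm Ψ η)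
    (hG : G.map (Rat.cast : ℚ → ℝ) = latticeGram Ψ η)
    (h : IsAlbertTypeIV (centerField Ψ hX) (endAlgRat Ψ) (rosatiEnd Ψ hη.1 hη.2.2 hG)) :
    ∃ e : InfinitePlace (centerField Ψ hX) → Fin 2 → Fin (Nat.sqrt (finrank (centerField Ψ hX) (endAlgRat Ψ))) →
        Fin (Nat.sqrt (finrank (centerField Ψ hX) (endAlgRat Ψ))) → Matrix κ κ ℂ,
      (∀ (w : InfinitePlace (centerField Ψ hX)) (s s' : Fin 2) (a b c d : Fin _),
        e w s a b * e w s' c d = if s = s' ∧ b = c then e w s a d else 0) ∧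
      (∀ w w' : InfinitePlace (centerField Ψ hX), w ≠ w' → ∀ (s s' : Fin 2) (a b c d : Fin _),
        e w s a b * e w' s' c d = 0) ∧
      (∑ w, ∑ s, ∑ a, e w s a a = 1) ∧
      (∀ w s a b, e w s a b ∈
        Submodule.span ℂ ((fun A : Matrix κ κ ℚ ↦ A.map (algebraMap ℚ ℂ)) '' (endAlgRat Ψ : Set (Matrix κ κ ℚ)))) ∧
      (∀ A ∈ endAlgRat Ψ, A.map (algebraMap ℚ ℂ) ∈ Submodule.span ℂ (Set.range
        fun p : InfinitePlace (centerField Ψ hX) × Fin 2 × Fin (Nat.sqrt (finrank (centerField Ψ hX) (endAlgRat Ψ))) ×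
          Fin (Nat.sqrt (finrank (centerField Ψ hX) (endAlgRat Ψ))) ↦ e p.1 p.2.1 p.2.2.1 p.2.2.2)) ∧
      (∀ w s a b, rosati (G.map (algebraMap ℚ ℂ)) (e w s a b) = e w s.rev b a) := by
  classical
  -- notation-free abbreviations
  obtain ⟨Φa, hΦa⟩ := hX.exists_algEquiv_pi_matrix_star_of_isAlbertTypeIV hη hG h
  obtain ⟨ψ, hψ⟩ := exists_baseChange_cm Ψ
  obtain ⟨θ, hθ⟩ : ∃ θ : (InfinitePlace (centerField Ψ hX) →
      Matrix (Fin (Nat.sqrt (finrank (centerField Ψ hX) (endAlgRat Ψ))))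
        (Fin (Nat.sqrt (finrank (centerField Ψ hX) (endAlgRat Ψ)))) ℂ) →ₐ[ℝ] Matrix κ κ ℝ,
      ∀ y, θ y = ψ (Φa.symm y) :=
    ⟨ψ.comp (Φa.symm : _ →ₐ[ℝ] ℝ ⊗[ℚ] endAlgRat Ψ), fun y ↦ rfl⟩
  have hGu : IsUnit G.det := isUnit_det_of_map_ratCast hG (isUnit_det_latticeGram Ψ hη.1 hη.2.2)
  have hGRu : IsUnit (G.map (Rat.cast : ℚ → ℝ)).det := by rw [hG]; exact isUnit_det_latticeGram Ψ hη.1 hη.2.2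
  have hGC : G.map (algebraMap ℚ ℂ) = (G.map (Rat.cast : ℚ → ℝ)).map (algebraMap ℝ ℂ) := map_algebraMap_eq_map_map_cm G
  have hGCu : IsUnit (G.map (algebraMap ℚ ℂ)).det := by
    rw [show G.map (algebraMap ℚ ℂ) = (algebraMap ℚ ℂ).mapMatrix G from rfl, ← RingHom.map_det]
    exact hGu.map _
  -- (a) rational endomorphisms through `θ`
  have hθf : ∀ f : endAlgRat Ψ, (f : Matrix κ κ ℚ).map (Rat.cast : ℚ → ℝ) = θ (Φa (1 ⊗ₜ f)) := fun f ↦ by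
    rw [hθ, AlgEquiv.symm_apply_apply, hψ, one_smul]
  -- (b) the Rosati involution is carried to factorwise conjugate transposition
  have hθS : ∀ y, rosati (G.map (Rat.cast : ℚ → ℝ)) (θ y) = θ (star y) := by
    have key : ∀ x : ℝ ⊗[ℚ] endAlgRat Ψ, rosati (G.map (Rat.cast : ℚ → ℝ)) (ψ x) = ψ (Φa.symm (star (Φa x))) := by
      intro x
      induction x using TensorProduct.induction_on with
      | zero => rw [map_zero, rosati_zero, map_zero, star_zero, map_zero, map_zero]
      | tmul r f =>
        have hrm := rosati_map (Rat.castHom ℝ) hGu (f : Matrix κ κ ℚ)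
        rw [Rat.coe_castHom] at hrm
        rw [← hΦa r f, AlgEquiv.symm_apply_apply, hψ, hψ, rosati_smul, coe_rosatiEnd, hrm]
      | add x y hx hy => rw [map_add, rosati_add, hx, hy, map_add, star_add, map_add, map_add]
    intro y
    rw [hθ, hθ, key, AlgEquiv.apply_symm_apply]
  -- (c) `θ` lands in the complexified span of `End_ℚ(X)`
  have hθspan : ∀ y, (θ y).map (algebraMap ℝ ℂ) ∈
      Submodule.span ℂ ((fun A : Matrix κ κ ℚ ↦ A.map (algebraMap ℚ ℂ)) '' (endAlgRat Ψ : Set (Matrix κ κ ℚ))) := by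
    have key : ∀ x : ℝ ⊗[ℚ] endAlgRat Ψ, (ψ x).map (algebraMap ℝ ℂ) ∈
        Submodule.span ℂ ((fun A : Matrix κ κ ℚ ↦ A.map (algebraMap ℚ ℂ)) '' (endAlgRat Ψ : Set (Matrix κ κ ℚ))) := by
      intro x
      induction x using TensorProduct.induction_on with
      | zero => rw [map_zero, Matrix.map_zero _ (map_zero _)]; exact Submodule.zero_mem _
      | tmul r f =>
        rw [hψ, Matrix.map_smul _ r (fun a ↦ by rw [Algebra.smul_def, Algebra.smul_def, map_mul]; rfl),
          ← map_algebraMap_eq_map_map_cm, ← algebraMap_smul ℂ r]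
        exact Submodule.smul_mem _ _ (Submodule.subset_span ⟨f, f.2, rfl⟩)
      | add x y hx hy => rw [map_add, Matrix.map_add _ (map_add _)]; exact Submodule.add_mem _ hx hy
    intro y
    rw [hθ]
    exact key _
  -- the complexification `C` and `θC = C ∘ θ`
  set C : Matrix κ κ ℝ →+* Matrix κ κ ℂ := (algebraMap ℝ ℂ).mapMatrix with hC_def
  have hC : ∀ X : Matrix κ κ ℝ, C X = X.map (algebraMap ℝ ℂ) := fun X ↦ rfl
  have csmul : ∀ (r : ℝ) (X : Matrix κ κ ℝ), C (r • X) = algebraMap ℝ ℂ r • C X := fun r X ↦ by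
    rw [hC, hC, algebraMap_smul,
      Matrix.map_smul (algebraMap ℝ ℂ) r (fun a ↦ by rw [Algebra.smul_def, Algebra.smul_def, map_mul]; rfl)]
  obtain ⟨θC, hθC⟩ : ∃ θC : (InfinitePlace (centerField Ψ hX) →
      Matrix (Fin (Nat.sqrt (finrank (centerField Ψ hX) (endAlgRat Ψ))))
        (Fin (Nat.sqrt (finrank (centerField Ψ hX) (endAlgRat Ψ)))) ℂ) →+* Matrix κ κ ℂ,
      ∀ y, θC y = C (θ y) := ⟨C.comp (θ : _ →+* Matrix κ κ ℝ), fun y ↦ rfl⟩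
  have θCsmul : ∀ (r : ℝ) y, θC (r • y) = algebraMap ℝ ℂ r • θC y := fun r y ↦ by rw [hθC, hθC, map_smul, csmul]
  have θCspan : ∀ y, θC y ∈
      Submodule.span ℂ ((fun A : Matrix κ κ ℚ ↦ A.map (algebraMap ℚ ℂ)) '' (endAlgRat Ψ : Set (Matrix κ κ ℚ))) :=
    fun y ↦ by rw [hθC, hC]; exact hθspan y
  have θCstar : ∀ y, rosati (G.map (algebraMap ℚ ℂ)) (θC y) = θC (star y) := fun y ↦ by
    rw [hθC, hθC, hC, hC, hGC, ← rosati_map (algebraMap ℝ ℂ) hGRu, hθS]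
  -- the block units `Pl w`, `q w = i · θ(δ_w i)`, the elementary units `Er w a b`
  obtain ⟨Pl, hPl⟩ : ∃ Pl : InfinitePlace (centerField Ψ hX) → Matrix κ κ ℂ,
      Pl = fun w ↦ θC (Pi.single w 1) := ⟨_, rfl⟩
  obtain ⟨q, hq⟩ : ∃ q : InfinitePlace (centerField Ψ hX) → Matrix κ κ ℂ,
      q = fun w ↦ (Complex.I : ℂ) • θC (Pi.single w ((Complex.I : ℂ) • (1 : Matrix _ _ ℂ))) := ⟨_, rfl⟩
  obtain ⟨Er, hEr⟩ : ∃ Er : InfinitePlace (centerField Ψ hX) → Fin (Nat.sqrt (finrank (centerField Ψ hX) (endAlgRat Ψ))) →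
      Fin (Nat.sqrt (finrank (centerField Ψ hX) (endAlgRat Ψ))) → Matrix κ κ ℂ,
      Er = fun w a b ↦ θC (Pi.single w (Matrix.single a b (1 : ℂ))) := ⟨_, rfl⟩
  have hPlw : ∀ w, Pl w = θC (Pi.single w 1) := fun w ↦ by rw [hPl]
  have hqw : ∀ w, q w = (Complex.I : ℂ) • θC (Pi.single w ((Complex.I : ℂ) • (1 : Matrix _ _ ℂ))) := fun w ↦ by rw [hq]
  have hErw : ∀ w a b, Er w a b = θC (Pi.single w (Matrix.single a b (1 : ℂ))) := fun w a b ↦ by rw [hEr]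
  -- relations: `Pl² = Pl`, `Pl q = q = q Pl`, `q² = Pl`; centrality of `Pl`, `q`; orthogonality across blocks
  have hPP : ∀ w, Pl w * Pl w = Pl w := fun w ↦ by rw [hPlw, ← map_mul, ← Pi.single_mul, mul_one]
  have hPq : ∀ w, Pl w * q w = q w := fun w ↦ by
    rw [hPlw, hqw, mul_smul_comm, ← map_mul, ← Pi.single_mul, one_mul]
  have hqP : ∀ w, q w * Pl w = q w := fun w ↦ by
    rw [hPlw, hqw, smul_mul_assoc, ← map_mul, ← Pi.single_mul, mul_one]
  have hqq : ∀ w, q w * q w = Pl w := fun w ↦ by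
    rw [hqw, hPlw, smul_mul_smul_comm, Complex.I_mul_I, ← map_mul, ← Pi.single_mul, smul_mul_smul_comm,
      Complex.I_mul_I, mul_one, neg_one_smul, neg_one_smul, Pi.single_neg, map_neg, neg_neg]
  have hPlc : ∀ w y, Pl w * θC y = θC y * Pl w := fun w y ↦ by
    rw [hPlw, ← map_mul, ← map_mul, show (Pi.single w 1 : InfinitePlace (centerField Ψ hX) → Matrix _ _ ℂ) =
      Pi.single w ((1 : ℂ) • (1 : Matrix _ _ ℂ)) by rw [one_smul], pi_single_smul_one_comm]
  have hqc : ∀ w y, q w * θC y = θC y * q w := fun w y ↦ by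
    rw [hqw, smul_mul_assoc, mul_smul_comm, ← map_mul, ← map_mul, pi_single_smul_one_comm]
  -- the central idempotents `p w 0 = ½(Pl − q)`, `p w 1 = ½(Pl + q)`
  obtain ⟨p, hp⟩ : ∃ p : InfinitePlace (centerField Ψ hX) → Fin 2 → Matrix κ κ ℂ,
      p = fun w s ↦ if s = 0 then (2 : ℂ)⁻¹ • (Pl w - q w) else (2 : ℂ)⁻¹ • (Pl w + q w) := ⟨_, rfl⟩
  have hp0 : ∀ w, p w 0 = (2 : ℂ)⁻¹ • (Pl w - q w) := fun w ↦ by rw [hp]; exact if_pos rfl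
  have hp1 : ∀ w, p w 1 = (2 : ℂ)⁻¹ • (Pl w + q w) := fun w ↦ by rw [hp]; exact if_neg (by decide)
  have hpc : ∀ w s y, p w s * θC y = θC y * p w s := by
    intro w s y
    fin_cases s
    · rw [show (⟨0, by norm_num⟩ : Fin 2) = 0 from rfl, hp0, smul_mul_assoc, mul_smul_comm, sub_mul, mul_sub, hPlc,
        hqc]
    · rw [show (⟨1, by norm_num⟩ : Fin 2) = 1 from rfl, hp1, smul_mul_assoc, mul_smul_comm, add_mul, mul_add, hPlc,
        hqc]
  have hpp : ∀ w (s s' : Fin 2), p w s * p w s' = if s = s' then p w s else 0 := by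
    intro w s s'
    obtain ⟨h00, h11, h01, h10, -, -⟩ := idempotent_pair (hPP w) (hPq w) (hqP w) (hqq w)
    fin_cases s <;> fin_cases s'
    · rw [show (⟨0, by norm_num⟩ : Fin 2) = 0 from rfl, hp0, h00, if_pos rfl]
    · rw [show (⟨0, by norm_num⟩ : Fin 2) = 0 from rfl, show (⟨1, by norm_num⟩ : Fin 2) = 1 from rfl, hp0, hp1, h01,
        if_neg (by decide)]
    · rw [show (⟨0, by norm_num⟩ : Fin 2) = 0 from rfl, show (⟨1, by norm_num⟩ : Fin 2) = 1 from rfl, hp0, hp1, h10,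
        if_neg (by decide)]
    · rw [show (⟨1, by norm_num⟩ : Fin 2) = 1 from rfl, hp1, h11, if_pos rfl]
  have hpsum : ∀ w, p w 0 + p w 1 = Pl w := fun w ↦ by
    rw [hp0, hp1]
    exact (idempotent_pair (hPP w) (hPq w) (hqP w) (hqq w)).2.2.2.2.1
  have hpdiff : ∀ w, p w 1 - p w 0 = q w := fun w ↦ by
    rw [hp0, hp1]
    exact (idempotent_pair (hPP w) (hPq w) (hqP w) (hqq w)).2.2.2.2.2
  -- the elementary units: table, trace, adjoints
  have rmul : ∀ (w w' : InfinitePlace (centerField Ψ hX)) (a b c d : Fin _),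
      Er w a b * Er w' c d = if w = w' ∧ b = c then Er w a d else 0 := by
    intro w w' a b c d
    rw [hErw, hErw, hErw, ← map_mul]
    by_cases hw : w = w'
    · subst hw
      rw [← Pi.single_mul, single_mul_single_cm]
      by_cases hbc : b = c
      · rw [if_pos hbc, if_pos ⟨rfl, hbc⟩]
      · rw [if_neg hbc, if_neg fun H ↦ hbc H.2, Pi.single_zero, map_zero]
    · rw [pi_single_mul_single_of_ne_cm hw, map_zero, if_neg fun H ↦ hw H.1]
  have rsum : ∀ w, ∑ a, Er w a a = Pl w := fun w ↦ by
    simp_rw [hErw]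
    rw [← map_sum, ← pi_single_sum_cm, sum_single_diag_one, hPlw]
  have PlEr : ∀ w a b, Pl w * Er w a b = Er w a b := fun w a b ↦ by
    rw [hPlw, hErw, ← map_mul, ← Pi.single_mul, one_mul]
  have Plsum : ∑ w, Pl w = 1 := by
    simp_rw [hPlw]
    have h2 := Finset.univ_sum_single (1 : InfinitePlace (centerField Ψ hX) → Matrix
      (Fin (Nat.sqrt (finrank (centerField Ψ hX) (endAlgRat Ψ)))) (Fin (Nat.sqrt (finrank (centerField Ψ hX) (endAlgRat Ψ)))) ℂ)
    simp only [Pi.one_apply] at h2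
    rw [← map_sum, h2, map_one]
  have rstar : ∀ w a b, rosati (G.map (algebraMap ℚ ℂ)) (Er w a b) = Er w b a := fun w a b ↦ by
    rw [hErw, θCstar, ← Pi.single_star, star_single_one, hErw]
  have Plstar : ∀ w, rosati (G.map (algebraMap ℚ ℂ)) (Pl w) = Pl w := fun w ↦ by
    rw [hPlw, θCstar, ← Pi.single_star, star_one]
  have qstar : ∀ w, rosati (G.map (algebraMap ℚ ℂ)) (q w) = -q w := fun w ↦ by
    rw [hqw, rosati_smul, θCstar, ← Pi.single_star, star_smul, Complex.star_def, Complex.conj_I, star_one, neg_smul,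
      Pi.single_neg, map_neg, smul_neg]
  have pstar : ∀ w s, rosati (G.map (algebraMap ℚ ℂ)) (p w s) = p w s.rev := by
    intro w s
    fin_cases s
    · rw [show (⟨0, by norm_num⟩ : Fin 2) = 0 from rfl, show (0 : Fin 2).rev = 1 from rfl, hp0, hp1, rosati_smul,
        rosati_sub, Plstar, qstar, sub_neg_eq_add]
    · rw [show (⟨1, by norm_num⟩ : Fin 2) = 1 from rfl, show (1 : Fin 2).rev = 0 from rfl, hp0, hp1, rosati_smul,
        rosati_add, Plstar, qstar, ← sub_eq_add_neg]
  -- membership of the idempotents in `span_ℂ End_ℚ(X)`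
  have pmem : ∀ w s, p w s ∈
      Submodule.span ℂ ((fun A : Matrix κ κ ℚ ↦ A.map (algebraMap ℚ ℂ)) '' (endAlgRat Ψ : Set (Matrix κ κ ℚ))) := by
    intro w s
    have hPlm : Pl w ∈ Submodule.span ℂ ((fun A : Matrix κ κ ℚ ↦ A.map (algebraMap ℚ ℂ)) ''
        (endAlgRat Ψ : Set (Matrix κ κ ℚ))) := by
      rw [hPlw]
      exact θCspan _
    have hqm : q w ∈ Submodule.span ℂ ((fun A : Matrix κ κ ℚ ↦ A.map (algebraMap ℚ ℂ)) ''
        (endAlgRat Ψ : Set (Matrix κ κ ℚ))) := by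
      rw [hqw]
      exact Submodule.smul_mem _ _ (θCspan _)
    fin_cases s
    · rw [show (⟨0, by norm_num⟩ : Fin 2) = 0 from rfl, hp0]
      exact Submodule.smul_mem _ _ (Submodule.sub_mem _ hPlm hqm)
    · rw [show (⟨1, by norm_num⟩ : Fin 2) = 1 from rfl, hp1]
      exact Submodule.smul_mem _ _ (Submodule.add_mem _ hPlm hqm)
  -- `θC` lands in the `ℂ`-span of the units `p w s · Er w a b`
  have hθCmem : ∀ y, θC y ∈ Submodule.span ℂ (Set.range
      fun r : InfinitePlace (centerField Ψ hX) × Fin 2 × Fin (Nat.sqrt (finrank (centerField Ψ hX) (endAlgRat Ψ))) ×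
        Fin (Nat.sqrt (finrank (centerField Ψ hX) (endAlgRat Ψ))) ↦ p r.1 r.2.1 * Er r.1 r.2.2.1 r.2.2.2) := by
    intro y
    have hunit : ∀ w a b, Er w a b ∈ Submodule.span ℂ (Set.range
        fun r : InfinitePlace (centerField Ψ hX) × Fin 2 × Fin (Nat.sqrt (finrank (centerField Ψ hX) (endAlgRat Ψ))) ×
          Fin (Nat.sqrt (finrank (centerField Ψ hX) (endAlgRat Ψ))) ↦ p r.1 r.2.1 * Er r.1 r.2.2.1 r.2.2.2) := by
      intro w a b
      rw [← PlEr, ← hpsum, add_mul]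
      exact Submodule.add_mem _ (Submodule.subset_span ⟨(w, 0, a, b), rfl⟩) (Submodule.subset_span ⟨(w, 1, a, b), rfl⟩)
    have hIunit : ∀ w a b, θC (Pi.single w (Matrix.single a b (Complex.I : ℂ))) ∈ Submodule.span ℂ (Set.range
        fun r : InfinitePlace (centerField Ψ hX) × Fin 2 × Fin (Nat.sqrt (finrank (centerField Ψ hX) (endAlgRat Ψ))) ×
          Fin (Nat.sqrt (finrank (centerField Ψ hX) (endAlgRat Ψ))) ↦ p r.1 r.2.1 * Er r.1 r.2.2.1 r.2.2.2) := by
      intro w a b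
      have h1 : θC (Pi.single w (Matrix.single a b (Complex.I : ℂ))) = (-Complex.I : ℂ) • (q w * Er w a b) := by
        rw [hqw, hErw, smul_mul_assoc, ← map_mul, ← Pi.single_mul, smul_mul_assoc, one_mul, Matrix.smul_single,
          smul_eq_mul, mul_one, smul_smul, neg_mul, Complex.I_mul_I, neg_neg, one_smul]
      rw [h1, ← hpdiff, sub_mul]
      exact Submodule.smul_mem _ _ (Submodule.sub_mem _ (Submodule.subset_span ⟨(w, 1, a, b), rfl⟩)
        (Submodule.subset_span ⟨(w, 0, a, b), rfl⟩))
    have hy : y = ∑ w, ∑ a, ∑ b, (Pi.single w (Matrix.single a b (y w a b)) :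
        InfinitePlace (centerField Ψ hX) → Matrix _ _ ℂ) := by
      conv_lhs => rw [← Finset.univ_sum_single y]
      refine Finset.sum_congr rfl fun w _ ↦ ?_
      conv_lhs => rw [Matrix.matrix_eq_sum_single (y w)]
      rw [pi_single_sum_cm]
      refine Finset.sum_congr rfl fun a _ ↦ ?_
      rw [pi_single_sum_cm]
    rw [hy]
    simp only [map_sum]
    refine Submodule.sum_mem _ fun w _ ↦ Submodule.sum_mem _ fun a _ ↦ Submodule.sum_mem _ fun b _ ↦ ?_
    rw [single_eq_re_smul_add_im_smul, Pi.single_add, map_add, Pi.single_smul, Pi.single_smul, θCsmul, θCsmul, ← hErw]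
    exact Submodule.add_mem _ (Submodule.smul_mem _ _ (hunit w a b)) (Submodule.smul_mem _ _ (hIunit w a b))
  -- the paired family
  refine ⟨fun w s a b ↦ p w s * Er w a b, fun w s s' a b c d ↦ ?_, fun w w' hw s s' a b c d ↦ ?_, ?_,
    fun w s a b ↦ ?_, fun A hA ↦ ?_, fun w s a b ↦ ?_⟩
  · -- the table, one block
    dsimp only
    rw [Matrix.mul_assoc, ← Matrix.mul_assoc (Er w a b), hErw, ← hpc, ← hErw, Matrix.mul_assoc, ← Matrix.mul_assoc,
      hpp, rmul]
    by_cases hs : s = s'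
    · subst hs
      rw [if_pos rfl]
      by_cases hbc : b = c
      · rw [if_pos ⟨rfl, hbc⟩, if_pos ⟨rfl, hbc⟩]
      · rw [if_neg fun H ↦ hbc H.2, if_neg fun H ↦ hbc H.2, Matrix.mul_zero]
    · rw [if_neg hs, Matrix.zero_mul, if_neg fun H ↦ hs H.1]
  · -- the table, two blocks
    dsimp only
    rw [Matrix.mul_assoc, ← Matrix.mul_assoc (Er w a b), hErw, ← hpc, ← hErw, Matrix.mul_assoc, ← Matrix.mul_assoc,
      rmul, if_neg fun H ↦ hw H.1, Matrix.mul_zero]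
  · -- completeness
    have h1 : ∀ w, ∑ s : Fin 2, ∑ a, p w s * Er w a a = Pl w := fun w ↦ by
      simp_rw [← Finset.mul_sum, rsum]
      rw [Fin.sum_univ_two, ← add_mul, hpsum, hPP]
    simp_rw [h1]
    exact Plsum
  · -- in `span_ℂ End_ℚ(X)`
    dsimp only
    rw [hErw]
    exact mul_mem_span_endAlgRat_cm Ψ (pmem w s) (θCspan _)
  · -- `End_ℚ(X) ⊆ span_ℂ` of the units
    rw [map_algebraMap_eq_map_map_cm A, ← hC, hθf ⟨A, hA⟩, ← hθC]
    exact hθCmem _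
  · -- pair-swapping adjoints
    dsimp only
    rw [rosati_mul hGCu, rstar, pstar, hErw, hpc, ← hErw]

end MatrixUnitPairs

/-! ## §3 Milne's table, type IV, every degree: `S(X)(ℂ)` is connected -/

section TypeFour

variable {κ : Type} [Fintype κ] [DecidableEq κ] [Nonempty κ] {E : Type*} [NormedAddCommGroup E]
  [NormedSpace ℂ E] {Ψ : (κ → ℝ) ≃L[ℝ] E} {η : E [⋀^Fin 2]→L[ℝ] ℝ} {G : Matrix κ κ ℚ}

/-- **MILNE 1999 §2, «SIMPLE ABELIAN VARIETY OF TYPE IV», AT TORUS LEVEL, EVERY DEGREE `d` — irreducibility**: for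
a simple polarised complex torus whose pair `(End_ℚ(X), ′)` is of Albert type IV (a central division algebra of degree
`d²` over a CM field with a positive involution of the second kind), the complex vanishing ideal of `S(X)(ℂ)` is prime
(`S(A)_{/k^al} ≅ ∏ GL`: «IV ∣ GL ∣ No ∣ Yes»). [cite: Milne1999LefschetzClasses, §2 «Simple abelian variety of type IV» (p. 651), Remark 2.2, Summary table (p. 652)]
[cite: Lange2023AbelianVarietiesComplex, Thm. 2.6.5 / §2.6.1 (type IV real structure)] -/
theorem IsSimple.isPrime_vanishingIdealC_lefschetzGroupC_of_isAlbertTypeIV (hX : IsSimple Ψ) (hη : IsRiemannForm Ψ η)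
    (hG : G.map (Rat.cast : ℚ → ℝ) = latticeGram Ψ η)
    (h : IsAlbertTypeIV (centerField Ψ hX) (endAlgRat Ψ) (rosatiEnd Ψ hη.1 hη.2.2 hG)) :
    (vanishingIdealC (lefschetzGroupC Ψ G)).IsPrime := by
  classical
  obtain ⟨e, hdiag, hoff, hone, hspan, habs, hadj⟩ := hX.exists_matrixUnitPairFamily_of_isAlbertTypeIV hη hG h
  -- `d ≥ 1`: otherwise the completeness relation reads `0 = 1`
  haveI : NeZero (Nat.sqrt (finrank (centerField Ψ hX) (endAlgRat Ψ))) := by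
    refine ⟨fun h0 ↦ ?_⟩
    haveI : IsEmpty (Fin (Nat.sqrt (finrank (centerField Ψ hX) (endAlgRat Ψ)))) := ⟨fun x ↦ (Fin.cast h0 x).elim0⟩
    have h1 := hone
    simp only [Finset.univ_eq_empty, Finset.sum_empty, Finset.sum_const_zero] at h1
    exact zero_ne_one h1
  have hmul : ∀ (w w' : InfinitePlace (centerField Ψ hX)) (s s' : Fin 2) (a b c d' : Fin _),
      e w s a b * e w' s' c d' = if w = w' ∧ s = s' ∧ b = c then e w s a d' else 0 := by
    intro w w' s s' a b c d'
    by_cases hw : w = w'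
    · subst hw
      rw [hdiag]
      by_cases hsc : s = s' ∧ b = c
      · rw [if_pos hsc, if_pos ⟨rfl, hsc⟩]
      · rw [if_neg hsc, if_neg fun H ↦ hsc H.2]
    · rw [hoff w w' hw, if_neg fun H ↦ hw H.1]
  exact isPrime_vanishingIdealC_lefschetzGroupC_of_matrixUnitPairFamily Ψ (transpose_eq_neg_of_map_ratCast Ψ hG)
    (isUnit_det_of_map_ratCast hG (isUnit_det_latticeGram Ψ hη.1 hη.2.2)) hmul hone hspan habs hadj

/-- **MILNE 1999 §2, TYPE IV, EVERY DEGREE: `Lf(X)(ℂ) = S(X)(ℂ)`** — for a simple polarised complex torus of Albert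
type IV, Lange's identity component `Lf(X)` is all of Milne's `S(X)`: the «Connected: Yes» entry of the table, type
IV, with no restriction on `d = √[End_ℚ(X) : K]` (the `d = 1` case is skel-4's
`IsSimple.lefschetzIdentityC_eq_lefschetzGroupC_of_isAlbertTypeIV_of_finrank_eq_one`).
[cite: Milne1999LefschetzClasses, §2 «Simple abelian variety of type IV» (p. 651) and Summary table (p. 652)]
[cite: Lange2023AbelianVarietiesComplex, §7.2.4 Exercise (4)] -/
theorem IsSimple.lefschetzIdentityC_eq_lefschetzGroupC_of_isAlbertTypeIV (hX : IsSimple Ψ) (hη : IsRiemannForm Ψ η)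
    (hG : G.map (Rat.cast : ℚ → ℝ) = latticeGram Ψ η)
    (h : IsAlbertTypeIV (centerField Ψ hX) (endAlgRat Ψ) (rosatiEnd Ψ hη.1 hη.2.2 hG)) :
    lefschetzIdentityC Ψ G = lefschetzGroupC Ψ G :=
  lefschetzIdentityC_eq_of_isPrime Ψ (hX.isPrime_vanishingIdealC_lefschetzGroupC_of_isAlbertTypeIV hη hG h)

/-- Real points: `Lf(X)(ℝ) = S(X)(ℝ) = lefschetzGroup Ψ η` for a simple polarised torus of Albert type IV.
[cite: Milne1999LefschetzClasses, §2 type IV («`S(A) = Res_{F₀/ℚ} U(φ)`») and Summary table]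
[cite: Lange2023AbelianVarietiesComplex, §7.2.4 Exercise (4)] -/
theorem IsSimple.lefschetzIdentity_eq_lefschetzGroup_of_isAlbertTypeIV (hX : IsSimple Ψ) (hη : IsRiemannForm Ψ η)
    (hG : G.map (Rat.cast : ℚ → ℝ) = latticeGram Ψ η)
    (h : IsAlbertTypeIV (centerField Ψ hX) (endAlgRat Ψ) (rosatiEnd Ψ hη.1 hη.2.2 hG)) :
    lefschetzIdentity Ψ G = lefschetzGroup Ψ η := by
  rw [← comap_lefschetzGroupC Ψ hG, ← hX.lefschetzIdentityC_eq_lefschetzGroupC_of_isAlbertTypeIV hη hG h]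
  rfl

end TypeFour

end ComplexTorus

end Literature.Geometry.Kaehler

end
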